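import Literature.NumberTheory.LFunctions.YoshidaWindowSpaces
import Literature.NumberTheory.LFunctions.WeilMarkovQuadratic
import Literature.Analysis.SpecialFunctions.DigammaVerticalSeries
import HarnessLib

/-!
# Yoshida's matrix coefficients `(χ_n, χ_m)` of the Weil Hermitian form on the window `[−a, a]` (1992, §5)

Source: H. Yoshida, *On Hermitian forms attached to zeta functions*, Adv. Stud. Pure Math. **21** (1992)
281–325, §5 "Some matrix coefficients", pp. 297–302, formulas (5.1), (5.15), (5.16)
[Yoshida1992HermitianForms]; case `k = ℚ` (`r₁ = 1`, `r₂ = 0`).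

"The positive definiteness of `( , )|K(a)` is, roughly speaking, equivalent to the positive definiteness of the
infinite dimensional hermitian matrix `((χ_n, χ_m))`.  Thus we are interested in calculating `(χ_n, χ_m)`
explicitly." (p. 297).  With `χ_n(x) = (2a)^{-1/2}exp(πinx/a)` on `[−a, a]` (`Yoshida1992.chi`, §3 p. 289) and
`ω_n := πn/a` (so `(2πn/a)² = 4ω_n²`, `4π²nm/a² = 4ω_nω_m`), Yoshida's final formulas (p. 301) read, for `k = ℚ`:

(5.15) `(χ_n, χ_n) = (4/a)(e^{a/2} − e^{−a/2})²(1 − 4ω_n²)/(1 + 4ω_n²)² − log π`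
         `− Σ_{p,e : e log p ≤ 2a} (log p) p^{−e/2}·2(1 − e log p/(2a)) cos(ω_n e log p)`
         `+ (1/2a){ −2 Σ_{k≥0} ((2k+½)² − ω_n²) e^{−2a(2k+½)}/((2k+½)² + ω_n²)² + 2a Re ψ(¼ + iω_n/2) + ½ Re ψ′(¼ + iω_n/2) }`,
(5.16) `(χ_n, χ_m) = (−1)^{n+m}(4/a)(e^{a/2} − e^{−a/2})²(1 − 4ω_nω_m)/((1 + 4ω_n²)(1 + 4ω_m²))`
         `− (−1)^{n+m}/(π(n−m)) Σ_{p,e : e log p ≤ 2a} (log p) p^{−e/2}(sin(ω_m e log p) − sin(ω_n e log p))`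
         `+ ((−1)^{n+m}/2a){ −2 Σ_{k≥0} ((2k+½)² − ω_nω_m) e^{−2a(2k+½)}/(((2k+½)² + ω_n²)((2k+½)² + ω_m²))`
         `+ (a/(π(n−m)))(Im ψ(¼ + iω_n/2) − Im ψ(¼ + iω_m/2)) }`   (`n ≠ m`).

This file DEFINES these coefficients in the tree's vocabulary (`weilPrimeIndex`, `Λ`, `digammaNode k = 2k + ½`,
`reDigammaQuarter t = Re ψ(¼ + it/2)`), split as `gramCoeff = polarCoeff + primeCoeff + archCoeff`, together with
the increment kernel `incrCoeff a t` (the matrix of `D_t(u) = ∫|u(x+t) − u(x)|²dx` on the `χ`-basis, `0 ≤ t ≤ 2a`;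
Yoshida's (5.2)/(5.3) integrated), through which the prime coefficient is `Σ_{log k<2a} Λ(k)k^{-1/2}(K_{log k} − 2δ)`
(`= ` the printed `p, e`-sums: `K_ℓ(n,n) − 2 = −2(1 − ℓ/2a)cos ω_nℓ`; the boundary length `ℓ = 2a`, included by
Yoshida and excluded by `weilPrimeIndex`, contributes `0` to both (5.15) and (5.16)).

Design choice (stated, not hidden): the off-diagonal exponential sum is defined in the SEPARATED form
`Σ_k e_k ω_m/(l_k² + ω_m²)` per index (`archExpSumSin`), and `archCoeff` combines
`(ω_m S — ω_n S)`-differences; this equals the printed product form since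
`((2k+½)² − ω_nω_m)/(((2k+½)²+ω_n²)((2k+½)²+ω_m²)) = (ω_n/((2k+½)²+ω_n²) − ω_m/((2k+½)²+ω_m²))/(ω_n − ω_m)` and
`ω_n − ω_m = π(n−m)/a` (term-wise algebra).  The separated form is what the position-side proof produces and what
an interval evaluator tabulates (one table `S(n)` per index instead of one per pair).

THE THEOREM that these ARE the matrix coefficients of the tree's window form
(`weilWindowForm a (Σ c_nχ_n) = Σ_nΣ_m Re(conj c_n·c_m)·gramCoeff a n m`) is proved problem-side in
`Summits/RiemannHypothesis/RiemannHypothesis/Theorems/WeilFormatCEntry*.lean` (seven files, rh-explicit weil-2);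
this file carries definitions and elementary symmetry facts only.  No named facts.
-/

noncomputable section

open Complex Set Finset
open scoped Real BigOperators ArithmeticFunction.vonMangoldt

namespace Literature.NumberTheory.LFunctions.Yoshida1992

open Literature.Analysis.SpecialFunctions

/-- The frequency `ω_n = πn/a` of `χ_n(x) = (2a)^{-1/2}e^{iω_n x}` (`exp(πinx/a)`, p. 289).
[cite: Yoshida1992HermitianForms, §3 p. 289] -/
def freq (a : ℝ) (n : ℤ) : ℝ := π * n / a

/-- **Polar coefficient** (5.1) = first term of (5.15)/(5.16):
`(−1)^{n+m}(4/a)(e^{a/2} − e^{−a/2})²(1 − 4ω_nω_m)/((1 + 4ω_n²)(1 + 4ω_m²))`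
(`= ∫ (χ_n ⋆ χ̃_m)(x)(e^{x/2} + e^{−x/2}) dx`). [cite: Yoshida1992HermitianForms, §5 (5.1) p. 297] -/
def polarCoeff (a : ℝ) (n m : ℤ) : ℝ :=
  (-1 : ℝ) ^ (n + m) * (4 / a) * (Real.exp (a / 2) - Real.exp (-(a / 2))) ^ 2 *
    (1 - 4 * freq a n * freq a m) / ((1 + 4 * freq a n ^ 2) * (1 + 4 * freq a m ^ 2))

/-- **Increment kernel** `K_t(n,m)`: the matrix of `D_t(u) = ∫|u(x+t) − u(x)|² dx` on the `χ`-basis for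
`0 ≤ t ≤ 2a` — `2 − 2(1 − t/2a)cos ω_n t` on the diagonal, `−(−1)^{n+m}(sin ω_m t − sin ω_n t)/(π(n−m))` off it
((5.2)/(5.3): `D_t(u) = 2‖u‖² − (F(t) + F(−t))`, `F = χ_n ⋆ χ̃_m`). [cite: Yoshida1992HermitianForms, §5 (5.2)-(5.3) p. 297] -/
def incrCoeff (a t : ℝ) (n m : ℤ) : ℝ :=
  if n = m then 2 - 2 * (1 - t / (2 * a)) * Real.cos (freq a n * t)
  else -(-1 : ℝ) ^ (n + m) * (Real.sin (freq a m * t) - Real.sin (freq a n * t)) / (π * (n - m))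

/-- **Prime coefficient** of (5.15)/(5.16): `Σ_{log k<2a} Λ(k)k^{-1/2}(K_{log k}(n,m) − 2δ_{nm})`, i.e.
`−Σ_{p,e} (log p)p^{−e/2}·2(1 − e log p/2a)cos(ω_n e log p)` (diagonal) and
`−(−1)^{n+m}/(π(n−m))·Σ_{p,e}(log p)p^{−e/2}(sin(ω_m e log p) − sin(ω_n e log p))` (off-diagonal).
[cite: Yoshida1992HermitianForms, §5 (5.15)-(5.16) p. 301] -/
def primeCoeff (a : ℝ) (n m : ℤ) : ℝ :=
  ∑ k ∈ weilPrimeIndex a, (Λ k : ℝ) / Real.sqrt k * (incrCoeff a (Real.log k) n m - if n = m then 2 else 0)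

/-- The **diagonal exponential sum** of (5.15): `Σ_{k≥0} e^{−2a l_k}(l_k² − ω_n²)/(l_k² + ω_n²)²`, `l_k = 2k + ½`
("the sums `Σ_{k=0}^∞` in them converge rapidly", p. 302). [cite: Yoshida1992HermitianForms, §5 (5.15) p. 301] -/
def archExpSumDiag (a : ℝ) (n : ℤ) : ℝ :=
  ∑' k : ℕ, Real.exp (-(2 * a * digammaNode k)) * ((digammaNode k ^ 2 - freq a n ^ 2) / (digammaNode k ^ 2 + freq a n ^ 2) ^ 2)

/-- The **off-diagonal exponential sum**, separated per index: `Σ_{k≥0} e^{−2a l_k} ω_n/(l_k² + ω_n²)`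
(the printed pair sum of (5.16) is `(archExpSumSin a n − archExpSumSin a m)/(ω_n − ω_m)`, see the module
docstring). [cite: Yoshida1992HermitianForms, §5 (5.16) p. 301] -/
def archExpSumSin (a : ℝ) (n : ℤ) : ℝ :=
  ∑' k : ℕ, Real.exp (-(2 * a * digammaNode k)) * (freq a n / (digammaNode k ^ 2 + freq a n ^ 2))

/-- **Archimedean coefficient** (`r₁ = 1`, `r₂ = 0` part of (5.15)/(5.16), with the `−log π` of (5.15)):
diagonal `Re ψ(¼ + iω_n/2) − log π + Re ψ′(¼ + iω_n/2)/(4a) − (1/a)·archExpSumDiag`,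
off-diagonal `−(−1)^{n+m}/(π(n−m))·[(½Im ψ(¼ + iω_m/2) − archExpSumSin m) − (½Im ψ(¼ + iω_n/2) − archExpSumSin n)]`.
[cite: Yoshida1992HermitianForms, §5 (5.15)-(5.16) p. 301] -/
def archCoeff (a : ℝ) (n m : ℤ) : ℝ :=
  if n = m then
    reDigammaQuarter (freq a n) - Real.log π +
      (deriv Complex.digamma (1 / 4 + ((freq a n : ℝ) : ℂ) / 2 * I)).re / (4 * a) - archExpSumDiag a n / a
  else -(-1 : ℝ) ^ (n + m) / (π * (n - m)) *
    (((Complex.digamma (1 / 4 + ((freq a m : ℝ) : ℂ) / 2 * I)).im / 2 - archExpSumSin a m) -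
      ((Complex.digamma (1 / 4 + ((freq a n : ℝ) : ℂ) / 2 * I)).im / 2 - archExpSumSin a n))

/-- **Yoshida's matrix coefficient `(χ_n, χ_m)`** (5.15)/(5.16) for `k = ℚ`: polar + prime + archimedean.
[cite: Yoshida1992HermitianForms, §5 (5.15)-(5.16) p. 301] -/
def gramCoeff (a : ℝ) (n m : ℤ) : ℝ :=
  polarCoeff a n m + primeCoeff a n m + archCoeff a n m

/-! ## Elementary symmetry (the matrix is real symmetric) -/

/-- `(−1)^{n+m}` is symmetric. [folklore] -/
private theorem neg_one_zpow_add_comm (n m : ℤ) : (-1 : ℝ) ^ (n + m) = (-1) ^ (m + n) := by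
  rw [add_comm]

/-- The polar coefficient is symmetric: `POL(n,m) = POL(m,n)`. [cite: Yoshida1992HermitianForms, §5 (5.1) p. 297] -/
theorem polarCoeff_comm (a : ℝ) (n m : ℤ) : polarCoeff a n m = polarCoeff a m n := by
  unfold polarCoeff
  rw [neg_one_zpow_add_comm]
  ring

/-- The increment kernel is symmetric: `K_t(n,m) = K_t(m,n)` (the kernels (5.2)/(5.3) satisfy `F_{n,m}(x) + F_{n,m}(−x)`
symmetric in `n, m`). [cite: Yoshida1992HermitianForms, §5 (5.2)-(5.3) p. 297] -/
theorem incrCoeff_comm (a t : ℝ) (n m : ℤ) : incrCoeff a t n m = incrCoeff a t m n := by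
  unfold incrCoeff
  by_cases h : n = m
  · subst h; rfl
  · rw [if_neg h, if_neg (Ne.symm h), neg_one_zpow_add_comm]
    rw [show (π * ((m : ℝ) - n)) = -(π * ((n : ℝ) - m)) by ring, div_neg, ← neg_div]
    ring

/-- The prime coefficient is symmetric. [cite: Yoshida1992HermitianForms, §5 (5.15)-(5.16) p. 301] -/
theorem primeCoeff_comm (a : ℝ) (n m : ℤ) : primeCoeff a n m = primeCoeff a m n := by
  unfold primeCoeff
  refine Finset.sum_congr rfl fun k _ ↦ ?_
  rw [incrCoeff_comm]
  by_cases h : n = m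
  · subst h; rfl
  · rw [if_neg h, if_neg (Ne.symm h)]

/-- The archimedean coefficient is symmetric. [cite: Yoshida1992HermitianForms, §5 (5.15)-(5.16) p. 301] -/
theorem archCoeff_comm (a : ℝ) (n m : ℤ) : archCoeff a n m = archCoeff a m n := by
  unfold archCoeff
  by_cases h : n = m
  · subst h; rfl
  · rw [if_neg h, if_neg (Ne.symm h), neg_one_zpow_add_comm]
    have h1 : (n : ℝ) - m ≠ 0 := by rw [sub_ne_zero]; exact_mod_cast h
    have h2 : (m : ℝ) - n ≠ 0 := by rw [sub_ne_zero]; exact_mod_cast (Ne.symm h)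
    rw [show (π * ((m : ℝ) - n)) = -(π * ((n : ℝ) - m)) by ring, div_neg]
    ring

/-- **`(χ_n, χ_m) = (χ_m, χ_n)`**: the matrix is real symmetric. [cite: Yoshida1992HermitianForms, §5 p. 297] -/
theorem gramCoeff_comm (a : ℝ) (n m : ℤ) : gramCoeff a n m = gramCoeff a m n := by
  rw [gramCoeff, gramCoeff, polarCoeff_comm, primeCoeff_comm, archCoeff_comm]

end Literature.NumberTheory.LFunctions.Yoshida1992
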